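import Literature.Computability.Complexity.RandomizingPolynomialsPerfect
import Literature.Computability.Complexity.RandomizingPolynomialsShape
import HarnessLib

/-!
# Randomizing polynomials X: the degree-3 block of a general branching-program matrix

File III of the series (`RandomizingPolynomialsBlock.lean`) writes the Ishai–Kushilevitz
randomization `R₁ · L · R₂` of the PATH matrix of a monomial as sparse polynomials; file IV proves it
is a perfect extension.  This file does the same for an ARBITRARY symbolic middle matrix — the
ingredient needed for the perfect randomized encoding of a general branching program
[Applebaum–Ishai–Kushilevitz 2006, Lemma 4.15; Ishai–Kushilevitz 2002, §3]:

* `gEntry n₀ d symX i k`, `gBlock n₀ d symX` — the entries on and above the diagonal of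
  `R₁ · X · R₂` for a symbolic matrix `symX : ℕ → ℕ → List (List ℕ)` (entry `(j, l)` a sparse
  polynomial), with the fresh variables of `R₁`, `R₂` numbered from `n₀` exactly as in file III
  (`symR1`, `symR2`, `pos`, `pairsLE`);
* `evalP_gEntry` / `evalM_gBlock_eq_iff` — values are the entries of `R₁(v) · X(v) · R₂(v)` for any
  semantics `X : (ℕ → ZMod 2) → Mat d` with `evalP v (symX j l) = X v j l`;
* `mem_gEntry` / `mem_gBlock` — if the entries of `symX` are affine (monomials of length `≤ 1`) in
  variables satisfying `S`, every output monomial has length `≤ 3` with variables in `S` or fresh in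
  `[n₀, n₀ + pos d d)`;
* `perfExt_gBlock` — **if every `X(v)` has branching-program shape (`IsBPShape`, file IX) and
  depends only on the valuation below `n₀`, the block is a perfect extension (file IV's `PerfExt`)
  of the corner value `v ↦ δ(X(v))`** with fresh variables `[n₀, n₀ + pos d d)` — from the three
  properties of file IX exactly as `perfExt_ikBlock` follows from file II.

Not here: the matrix of a concrete branching program (next file).

## References

* B. Applebaum, Y. Ishai, E. Kushilevitz, *Cryptography in NC⁰*, SIAM J. Comput. 36 (2006), §4.3,
  Lemma 4.15.
* Y. Ishai, E. Kushilevitz, ICALP 2002, §3.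
-/

namespace Literature.Computability.Complexity

namespace RandPoly

open Matrix Finset

/-! ### The symbolic block -/

/-- Entry `(i, k)` of the symbolic product `R₁ · X · R₂` for a symbolic middle matrix `symX`.
[cite: IshaiKushilevitz2002, §3] -/
def gEntry (n₀ d : ℕ) (symX : ℕ → ℕ → List (List ℕ)) (i k : ℕ) : List (List ℕ) :=
  (List.range (d + 1)).flatMap fun j => (List.range (d + 1)).flatMap fun l =>
    mulP (mulP (symR1 n₀ i j) (symX j l)) (symR2 n₀ d l k)

/-- **The block of a symbolic matrix**: the entries `(i, k)`, `i ≤ k ≤ d`, of `R₁ · X · R₂`, fresh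
variables numbered from `n₀`. [cite: ApplebaumIshaiKushilevitz2006, Lemma 4.15] -/
def gBlock (n₀ d : ℕ) (symX : ℕ → ℕ → List (List ℕ)) : List (List (List ℕ)) :=
  (pairsLE d).map fun ik => gEntry n₀ d symX ik.1 ik.2

/-- The block has `(d + 1)(d + 2)/2` outputs. [folklore] -/
theorem length_gBlock (n₀ d : ℕ) (symX : ℕ → ℕ → List (List ℕ)) :
    (gBlock n₀ d symX).length = (pairsLE d).length := by
  simp [gBlock]

/-! ### Values -/

variable {d : ℕ} {v w : ℕ → ZMod 2}

/-- **The entries evaluate to the entries of `R₁ · X · R₂`.** [cite: IshaiKushilevitz2002, §3] -/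
theorem evalP_gEntry (n₀ : ℕ) {symX : ℕ → ℕ → List (List ℕ)} {X : (ℕ → ZMod 2) → Mat d}
    (hX : ∀ (v : ℕ → ZMod 2) (j l : Fin (d + 1)), evalP v (symX j.val l.val) = X v j l)
    (v : ℕ → ZMod 2) (i k : Fin (d + 1)) :
    evalP v (gEntry n₀ d symX i.val k.val) = (matR1 n₀ d v * X v * matR2 n₀ d v) i k := by
  rw [gEntry, evalP_flatMap, sum_map_range, Finset.sum_range, Matrix.mul_apply]
  simp_rw [evalP_flatMap, sum_map_range, Finset.sum_range, evalP_mulP, Matrix.mul_apply,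
    Finset.sum_mul]
  rw [Finset.sum_comm]
  refine Finset.sum_congr rfl fun l _ => Finset.sum_congr rfl fun j _ => ?_
  rw [evalP_symR1, hX, evalP_symR2]

/-- **Equality of the values of two blocks is equality of the projections of the matrix products.**
[cite: IshaiKushilevitz2002, §3] -/
theorem evalM_gBlock_eq_iff (n₀ : ℕ) {symX : ℕ → ℕ → List (List ℕ)} {X : (ℕ → ZMod 2) → Mat d}
    (hX : ∀ (v : ℕ → ZMod 2) (j l : Fin (d + 1)), evalP v (symX j.val l.val) = X v j l)
    (v w : ℕ → ZMod 2) :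
    evalM v (gBlock n₀ d symX) = evalM w (gBlock n₀ d symX) ↔
      ∀ i k : Fin (d + 1), i ≤ k →
        (matR1 n₀ d v * X v * matR2 n₀ d v) i k = (matR1 n₀ d w * X w * matR2 n₀ d w) i k := by
  simp only [gBlock, evalM, List.map_map]
  rw [List.map_inj_left]
  constructor
  · intro h i k hik
    have := h (i.val, k.val) (mem_pairsLE.2 ⟨hik, Nat.le_of_lt_succ k.isLt⟩)
    simpa only [Function.comp_apply, evalP_gEntry n₀ hX] using this
  · rintro h ⟨i, k⟩ hik
    obtain ⟨hik, hkd⟩ := mem_pairsLE.1 hik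
    have hi : i < d + 1 := by simp only at hik hkd; omega
    have hk : k < d + 1 := by simp only at hkd; omega
    have h1 := h ⟨i, hi⟩ ⟨k, hk⟩ hik
    rw [← evalP_gEntry n₀ hX, ← evalP_gEntry n₀ hX] at h1
    exact h1

/-! ### Degree and support -/

/-- **Every monomial of an entry has length `≤ 3`** when the middle matrix is affine: its variables
are variables of `symX` (satisfying `S`) or fresh variables `n₀ + pos a b`, `a ≤ b ≤ d`,
`(a, b) ≠ (d, d)`. [cite: ApplebaumIshaiKushilevitz2006, Lemma 4.15] -/
theorem mem_gEntry {n₀ d : ℕ} {symX : ℕ → ℕ → List (List ℕ)} {S : ℕ → Prop}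
    (hsym : ∀ j l, ∀ μ ∈ symX j l, μ.length ≤ 1 ∧ ∀ x ∈ μ, S x) {i k : ℕ} {μ : List ℕ}
    (h : μ ∈ gEntry n₀ d symX i k) :
    μ.length ≤ 3 ∧ ∀ x ∈ μ, S x ∨ ∃ a b, a ≤ b ∧ b ≤ d ∧ (a < b ∨ b < d) ∧ x = n₀ + pos a b := by
  simp only [gEntry, List.mem_flatMap, List.mem_range] at h
  obtain ⟨j, hj, l, hl, hμ⟩ := h
  obtain ⟨μ₁₂, h₁₂, μ₃, h₃, rfl⟩ := mem_mulP hμ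
  obtain ⟨μ₁, h₁, μ₂, h₂, rfl⟩ := mem_mulP h₁₂
  obtain ⟨hl₁, hx₁⟩ := mem_symR1 h₁
  obtain ⟨hl₂, hx₂⟩ := hsym j l μ₂ h₂
  obtain ⟨hl₃, hx₃⟩ := mem_symR2 h₃
  refine ⟨by simp only [List.length_append]; omega, fun x hx => ?_⟩
  simp only [List.mem_append] at hx
  rcases hx with (hx | hx) | hx
  · obtain ⟨rfl, hij⟩ := hx₁ x hx
    exact Or.inr ⟨i, j, le_of_lt hij, by omega, Or.inl hij, rfl⟩
  · exact Or.inl (hx₂ x hx)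
  · obtain ⟨rfl, hld⟩ := hx₃ x hx
    exact Or.inr ⟨l, l, le_rfl, by omega, Or.inr hld, rfl⟩

/-- **Degree and support of the block**: every monomial has length `≤ 3` and its variables satisfy
`S` or are fresh variables in `[n₀, n₀ + pos d d)`. [cite: ApplebaumIshaiKushilevitz2006, Lemma 4.15] -/
theorem mem_gBlock {n₀ d : ℕ} {symX : ℕ → ℕ → List (List ℕ)} {S : ℕ → Prop}
    (hsym : ∀ j l, ∀ μ ∈ symX j l, μ.length ≤ 1 ∧ ∀ x ∈ μ, S x) {q : List (List ℕ)}
    (hq : q ∈ gBlock n₀ d symX) {μ : List ℕ} (hμ : μ ∈ q) :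
    μ.length ≤ 3 ∧ ∀ x ∈ μ, S x ∨ (n₀ ≤ x ∧ x < n₀ + pos d d) := by
  simp only [gBlock, List.mem_map] at hq
  obtain ⟨⟨i, k⟩, -, rfl⟩ := hq
  obtain ⟨hlen, hx⟩ := mem_gEntry hsym hμ
  refine ⟨hlen, fun x hxμ => ?_⟩
  rcases hx x hxμ with h | ⟨a, b, hab, hbd, hor, rfl⟩
  · exact Or.inl h
  · exact Or.inr ⟨Nat.le_add_right _ _, by have := pos_lt_pos_self hab hbd hor; omega⟩

/-! ### The block is a perfect extension of the corner value -/

/-- A valuation over the prefix of `w` realising given randomizers `(A', B')` on the fresh block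
(the fresh variable `n₀ + pos a b` reads `A' a b` for `a < b`, `B' a d` for `a = b < d`). [folklore] -/
noncomputable def realise (n₀ d : ℕ) (w : ℕ → ZMod 2) (A' B' : Mat d) : ℕ → ZMod 2 := fun m =>
  if m < n₀ then w m else
    match (pairsLE d).find? (fun ab => n₀ + pos ab.1 ab.2 = m) with
    | some ab =>
      if h : ab.1 < ab.2 ∧ ab.2 < d + 1 then A' ⟨ab.1, by omega⟩ ⟨ab.2, h.2⟩
      else if h : ab.1 = ab.2 ∧ ab.2 < d then B' ⟨ab.1, by omega⟩ (Fin.last d)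
      else w m
    | none => w m

/-- `realise` agrees with `w` below `n₀`. [folklore] -/
theorem agreeBelow_realise (n₀ d : ℕ) (w : ℕ → ZMod 2) (A' B' : Mat d) :
    AgreeBelow n₀ (realise n₀ d w A' B') w := fun m hm => by
  simp [realise, hm]

/-- `R₁` read off `realise … A' B'` is `A'`. [folklore] -/
theorem matR1_realise (n₀ : ℕ) (w : ℕ → ZMod 2) {A' B' : Mat d} (hA' : IsUnitri A') :
    matR1 n₀ d (realise n₀ d w A' B') = A' := by
  ext i j
  rcases lt_trichotomy i j with hij | rfl | hji
  · rw [matR1_apply_of_lt n₀ _ hij]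
    have hfind := find?_pairsLE_pos (d := d) n₀ (le_of_lt (Fin.lt_def.1 hij)) (Nat.le_of_lt_succ j.isLt)
    simp only [realise, if_neg (by omega : ¬ (n₀ + pos i.val j.val < n₀)), hfind]
    rw [dif_pos ⟨Fin.lt_def.1 hij, j.isLt⟩]
  · rw [(matR1_isUnitri n₀ d _).1, hA'.1]
  · rw [(matR1_isUnitri n₀ d _).2 i j hji, hA'.2 i j hji]

/-- `R₂` read off `realise … A' B'` is `B'`. [folklore] -/
theorem matR2_realise (n₀ : ℕ) (w : ℕ → ZMod 2) {A' B' : Mat d} (hB' : IsLastCol B') :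
    matR2 n₀ d (realise n₀ d w A' B') = B' := by
  ext l k
  by_cases hk : k = Fin.last d
  · subst hk
    by_cases hl : l = Fin.last d
    · rw [hl, (matR2_isLastCol n₀ d _).1, hB'.1]
    · rw [matR2_apply_last n₀ _ hl]
      have hld : l.val < d := Fin.val_lt_last hl
      have hfind := find?_pairsLE_pos (d := d) n₀ (le_refl l.val) (le_of_lt hld)
      simp only [realise, if_neg (by omega : ¬ (n₀ + pos l.val l.val < n₀)), hfind]
      split_ifs with h1 h2
      · exact absurd h1.1 (lt_irrefl _)
      · rfl
      · exact absurd ⟨trivial, hld⟩ h2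
  · by_cases hlk : l = k
    · subst hlk; rw [(matR2_isLastCol n₀ d _).1, hB'.1]
    · rw [(matR2_isLastCol n₀ d _).2 l k hlk hk, hB'.2 l k hlk hk]

/-- **The block of a shape matrix is a perfect extension of its corner value.**  If every `X(v)`
has branching-program shape and `X(v)` depends only on `v` below `n₀`, then `gBlock n₀ d symX`
perfectly extends `v ↦ δ(X(v))` with fresh variables `[n₀, n₀ + pos d d)`: injective on the fresh
variables, the outputs decode `δ`, and their range depends only on `δ`.
[cite: ApplebaumIshaiKushilevitz2006, Lemma 4.15] -/
theorem perfExt_gBlock (n₀ : ℕ) {symX : ℕ → ℕ → List (List ℕ)} {X : (ℕ → ZMod 2) → Mat d}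
    (hX : ∀ (v : ℕ → ZMod 2) (j l : Fin (d + 1)), evalP v (symX j.val l.val) = X v j l)
    (hshape : ∀ v, IsBPShape (X v)) (hagree : ∀ v w, AgreeBelow n₀ v w → X v = X w) :
    PerfExt n₀ (n₀ + pos d d) (gBlock n₀ d symX) (fun v => corner (X v)) := by
  refine ⟨fun v w hvw he => ?_, fun v w he => ?_, fun v w hf => ?_⟩
  · -- injectivity on the fresh block
    rw [evalM_gBlock_eq_iff n₀ hX, hagree v w hvw] at he
    obtain ⟨hA, hB⟩ := eq_of_proj_eq_of_isBPShape (hshape w) (matR1_isUnitri n₀ d v)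
      (matR1_isUnitri n₀ d w) (matR2_isLastCol n₀ d v) (matR2_isLastCol n₀ d w) he
    intro m hm
    by_cases hmn : m < n₀
    · exact hvw m hmn
    obtain ⟨i, k, hik, hkd, hor, hpos⟩ := exists_pos_eq (m := m - n₀) (d := d) (by omega)
    have hm' : m = n₀ + pos i k := by omega
    rw [hm']
    have hk1 : k < d + 1 := by omega
    by_cases hlt : i < k
    · have h1 := congrFun (congrFun hA ⟨i, by omega⟩) ⟨k, hk1⟩
      rwa [matR1_apply_of_lt n₀ v (Fin.mk_lt_mk.2 hlt), matR1_apply_of_lt n₀ w (Fin.mk_lt_mk.2 hlt)]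
        at h1
    · have hik' : i = k := by omega
      subst hik'
      have hkd' : i < d := by omega
      have hne : (⟨i, hk1⟩ : Fin (d + 1)) ≠ Fin.last d := fun h' => by
        have := congrArg Fin.val h'; simp at this; omega
      have h1 := congrFun (congrFun hB ⟨i, hk1⟩) (Fin.last d)
      rwa [matR2_apply_last n₀ v hne, matR2_apply_last n₀ w hne] at h1
  · -- decodability
    rw [evalM_gBlock_eq_iff n₀ hX] at he
    exact corner_eq_of_proj_eq (hshape v) (hshape w) (matR1_isUnitri n₀ d v) (matR1_isUnitri n₀ d w)
      (matR2_isLastCol n₀ d v) (matR2_isLastCol n₀ d w) he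
  · -- range
    obtain ⟨A', B', hA', hB', heq⟩ :=
      exists_proj_eq_of_corner_eq (hshape v) (hshape w) hf (matR1_isUnitri n₀ d v) (matR2_isLastCol n₀ d v)
    refine ⟨realise n₀ d w A' B', agreeBelow_realise n₀ d w A' B', ?_⟩
    rw [evalM_gBlock_eq_iff n₀ hX, matR1_realise n₀ w hA', matR2_realise n₀ w hB',
      hagree _ w (agreeBelow_realise n₀ d w A' B'), heq]
    exact fun _ _ _ => rfl

end RandPoly

end Literature.Computability.Complexity
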